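import Literature.Computability.AlgebraicComplexity.ArithCircuitProjections
import Literature.Computability.AlgebraicComplexity.DepthThreeChasmCircuits
import Literature.Computability.AlgebraicComplexity.ValiantConjectureEquivProofs
import Literature.Computability.AlgebraicComplexity.ValiantCompleteness
import Literature.Computability.AlgebraicComplexity.StandardFamiliesProofs
import Literature.Computability.AlgebraicComplexity.IMMInVPProofs
import Summits.ValiantsHypothesis.ValiantsHypothesis.Theorems.DepthWindowConstDepth
import Summits.ValiantsHypothesis.ValiantsHypothesis.Theorems.DepthWindowLSTExplicit
import HarnessLib

/-!
# Route `DepthWindow` — the growing-depth rung: `per` is hard at product-depth `⌊log₂log₂log₂ n⌋ / 3`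

Helper file of the route `Theses/DepthWindow.lean` (decomp-valiant workshop, lens 4, generation 3).  The crux
`PerHardLog3` asks that `per` have no polynomial-wire circuits over `ℂ` of product-depth `⌊log₂⌊log₂⌊log₂ n⌋⌋⌋ + 1`
(`κ = 1`); generation 2 proved the CONSTANT-depth rung `perHardConstDepth`.  Here, the first rung with UNBOUNDED
product-depth: `perHardGrowingDepth` (`κ = 1/3`) — no `c` such that every `per_n` has a circuit of product-depth
`≤ ⌊log₂⌊log₂⌊log₂ n⌋⌋⌋ / 3` with `≤ n ^ c + c` wires; `perHardGrowingDepth_lst` = its registered-stub (`∀ c ∃ n`) form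
(WEAKER than the crux by `DepthWindowDial.perHardAtDepth_anti`: a smaller depth budget admits fewer circuits).
Mechanism: the explicit-constant LST bound `lst_explicit` (`DepthWindowLSTExplicit.lean`; `μ_Δ ≥ 2^{-(2Δ+1)}`) for the
`VP` family `m ↦ IMM_{m, d(m)}`, `d(m) = min m ⌊μ_{Δ⁺(m)}/(30000 Δ⁺(m)) · log m⌋`, `Δ⁺(m) = ⌊log₂log₂log₂ m⌋/3 + 1`,
transported to the `VNP`-complete permanent along a p-projection (`isVNPComplete_perPoly_holds`,
`exists_circuit_of_isProjection`), evaluated at ONE tower `m = 2^(2^(2^(3X)))`, `X = a + b + 16`, where all side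
conditions are crude dyadic arithmetic (`tower_arith`, `tower_facts`): transported depth `≤ X + 1 = Δ⁺(m)`,
`ε log m ≥ W := B^{2^{2Δ+2}}` (`B = 409600 Δ² + 1440 (Δ+1) + b + 1`), `d(m)^{μ/2} ≥ B ≥ b + 1`, `m^{b+1} ≤ size ≤ m^b + b`.
Rung currency only: tree line of the dial from constant depth to `⌊log₂log₂log₂ n⌋/3`; print line `κ < 0.72`
[BhargavDuttaSaxena2024, Thm 1.1 / Rem. 1.6]; crux at `κ = 1 (+1)`.  Unconditional, 0 sorry, def-free.
References: [LimayeSrinivasanTavenas2025] Cor. 4, Claim 16; [Valiant1979]; [Burgisser2000TCS] §2; [BhargavDuttaSaxena2024].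
-/

-- layout Summits/ValiantsHypothesis/ValiantsHypothesis forces the duplicated namespace component
set_option linter.dupNamespace false

namespace Summit.ValiantsHypothesis.ValiantsHypothesis.Theorems.DepthWindow

open MvPolynomial Real Literature.Computability.AlgebraicComplexity ArithCircuit
open Literature.Computability.AlgebraicComplexity.LSTWord
open Literature.Computability.Complexity

noncomputable section

/-! ### Dyadic bookkeeping at the tower -/

/-- `⌊log₂⌊log₂⌊log₂ 2^(2^(2^Y))⌋⌋⌋ = Y`. [folklore] -/
theorem log3_tower (Y : ℕ) : Nat.log 2 (Nat.log 2 (Nat.log 2 (2 ^ (2 ^ (2 ^ Y))))) = Y := by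
  rw [Nat.log_pow one_lt_two, Nat.log_pow one_lt_two, Nat.log_pow one_lt_two]

/-- A polynomially larger index does not raise `⌊log₂log₂log₂ ·⌋` by more than one at the tower:
`t ≤ m^a + a`, `m = 2^(2^(2^Y))`, `a + 1 ≤ 2^Y` give `⌊log₂⌊log₂⌊log₂ t⌋⌋⌋ ≤ Y + 1`. [folklore] -/
theorem log3_le_of_le_tower_pow (Y a t : ℕ) (ha : a + 1 ≤ 2 ^ Y)
    (ht : t ≤ (2 ^ (2 ^ (2 ^ Y))) ^ a + a) : Nat.log 2 (Nat.log 2 (Nat.log 2 t)) ≤ Y + 1 := by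
  obtain ⟨E, hE⟩ : ∃ E, E = 2 ^ (2 ^ Y) := ⟨_, rfl⟩
  rw [← hE] at ht
  have hE1 : 1 ≤ E := hE ▸ Nat.one_le_two_pow
  have hY : Y < 2 ^ Y := Nat.lt_two_pow_self
  -- `t ≤ 2^(E a + a)`
  have h1 : t ≤ 2 ^ (E * a + a) := by
    have hp : 1 ≤ (2 ^ E) ^ a := Nat.one_le_pow _ _ (Nat.pos_of_ne_zero (by positivity))
    have ha2 : a < 2 ^ a := Nat.lt_two_pow_self
    calc t ≤ (2 ^ E) ^ a + a := ht
      _ ≤ (2 ^ E) ^ a * 2 ^ a := by nlinarith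
      _ = 2 ^ (E * a + a) := by rw [← pow_mul, ← pow_add]
  have h2 : Nat.log 2 t ≤ E * a + a :=
    (Nat.log_mono_right h1).trans (Nat.log_pow one_lt_two _).le
  -- `E a + a ≤ 2^(2^Y + Y + 1)`
  have h3 : E * a + a ≤ 2 ^ (2 ^ Y + Y + 1) := by
    have h3a : E * a + a = (E + 1) * a := by ring
    have h3b : (E + 1) * a ≤ (2 * E) * 2 ^ Y := Nat.mul_le_mul (by omega) (by omega)
    have h3c : (2 * E) * 2 ^ Y = 2 ^ (2 ^ Y + Y + 1) := by
      rw [hE, show 2 ^ Y + Y + 1 = (2 ^ Y + 1) + Y by ring, pow_add, pow_succ]; ring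
    omega
  have h4 : Nat.log 2 (Nat.log 2 t) ≤ 2 ^ Y + Y + 1 :=
    (Nat.log_mono_right h2).trans ((Nat.log_mono_right h3).trans (Nat.log_pow one_lt_two _).le)
  have h5 : 2 ^ Y + Y + 1 ≤ 2 ^ (Y + 1) := by rw [pow_succ]; omega
  calc Nat.log 2 (Nat.log 2 (Nat.log 2 t)) ≤ Nat.log 2 (2 ^ (Y + 1)) :=
        Nat.log_mono_right (h4.trans h5)
    _ = Y + 1 := Nat.log_pow one_lt_two _

/-- `B := 409600 (X+1)² + 1440 (X+2) + b + 1 ≤ 2^(2X)` for `b + 16 ≤ X`. [folklore] -/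
theorem towerB_le (X b : ℕ) (hX : b + 16 ≤ X) :
    409600 * (X + 1) ^ 2 + 1440 * (X + 2) + b + 1 ≤ 2 ^ (2 * X) := by
  obtain ⟨Z, rfl⟩ : ∃ Z, X = Z + 16 := ⟨X - 16, by omega⟩
  have hZ : Z < 2 ^ Z := Nat.lt_two_pow_self
  have h1 : Z + 16 + 2 ≤ 2 ^ (Z + 5) := by rw [pow_add]; omega
  have h2 : (Z + 16 + 1) ^ 2 ≤ 2 ^ (2 * Z + 10) := by
    calc (Z + 16 + 1) ^ 2 ≤ (2 ^ (Z + 5)) ^ 2 := Nat.pow_le_pow_left (by omega) 2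
      _ = 2 ^ (2 * Z + 10) := by rw [← pow_mul]; congr 1; ring
  have e1 : 409600 * (Z + 16 + 1) ^ 2 ≤ 2 ^ (2 * Z + 29) := by
    calc 409600 * (Z + 16 + 1) ^ 2 ≤ 2 ^ 19 * 2 ^ (2 * Z + 10) := Nat.mul_le_mul (by norm_num) h2
      _ = 2 ^ (2 * Z + 29) := by rw [← pow_add]; congr 1; ring
  have e2 : 1440 * (Z + 16 + 2) ≤ 2 ^ (2 * Z + 29) := by
    calc 1440 * (Z + 16 + 2) ≤ 2 ^ 11 * 2 ^ (Z + 5) := Nat.mul_le_mul (by norm_num) h1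
      _ = 2 ^ (Z + 16) := by rw [← pow_add, show 11 + (Z + 5) = Z + 16 by ring]
      _ ≤ 2 ^ (2 * Z + 29) := Nat.pow_le_pow_right two_pos (by omega)
  have e3 : b + 1 ≤ 2 ^ (2 * Z + 29) :=
    (show b + 1 ≤ 2 ^ (Z + 5) by rw [pow_add]; omega).trans (Nat.pow_le_pow_right two_pos (by omega))
  have e4 : 2 ^ (2 * (Z + 16)) = 8 * 2 ^ (2 * Z + 29) := by
    rw [show 2 * (Z + 16) = (2 * Z + 29) + 3 by ring, pow_add]; ring
  rw [e4]
  linarith [e1, e2, e3]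

/-- **The side conditions at the tower** `m = 2^(2^(2^(3X)))`, `b + 16 ≤ X`:
`60000 (X+1) · 2^{2(X+1)+1} · B^{2 · 2^{2(X+1)+1}} ≤ 2^(2^(3X))` (`B` as in `towerB_le`). [folklore] -/
theorem tower_arith (X b : ℕ) (hX : b + 16 ≤ X) :
    60000 * (X + 1) * 2 ^ (2 * (X + 1) + 1) *
        (409600 * (X + 1) ^ 2 + 1440 * (X + 2) + b + 1) ^ (2 * 2 ^ (2 * (X + 1) + 1))
      ≤ 2 ^ (2 ^ (3 * X)) := by
  have hB := towerB_le X b hX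
  obtain ⟨Z, rfl⟩ : ∃ Z, X = Z + 16 := ⟨X - 16, by omega⟩
  have hZ : Z < 2 ^ Z := Nat.lt_two_pow_self
  have h3Z : 3 * Z < 2 ^ (3 * Z) := Nat.lt_two_pow_self
  -- first factor `≤ 2^(3Z+56)`
  have hF : 60000 * (Z + 16 + 1) * 2 ^ (2 * (Z + 16 + 1) + 1) ≤ 2 ^ (3 * Z + 56) := by
    have h17 : Z + 16 + 1 ≤ 2 ^ (Z + 5) := by rw [pow_add]; omega
    calc 60000 * (Z + 16 + 1) * 2 ^ (2 * (Z + 16 + 1) + 1)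
        ≤ 2 ^ 16 * 2 ^ (Z + 5) * 2 ^ (2 * (Z + 16 + 1) + 1) :=
          Nat.mul_le_mul_right _ (Nat.mul_le_mul (by norm_num) h17)
      _ = 2 ^ (3 * Z + 56) := by rw [← pow_add, ← pow_add]; congr 1; ring
  -- second factor `≤ 2^((2Z+32) · 2^(2Z+36))`
  have hS : (409600 * (Z + 16 + 1) ^ 2 + 1440 * (Z + 16 + 2) + b + 1) ^ (2 * 2 ^ (2 * (Z + 16 + 1) + 1))
      ≤ 2 ^ ((2 * (Z + 16)) * 2 ^ (2 * Z + 36)) := by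
    have hexp : 2 * 2 ^ (2 * (Z + 16 + 1) + 1) = 2 ^ (2 * Z + 36) := by
      rw [show 2 * Z + 36 = (2 * (Z + 16 + 1) + 1) + 1 by ring, pow_succ]; ring
    rw [hexp]
    calc _ ≤ (2 ^ (2 * (Z + 16))) ^ (2 ^ (2 * Z + 36)) := Nat.pow_le_pow_left hB _
      _ = 2 ^ ((2 * (Z + 16)) * 2 ^ (2 * Z + 36)) := by rw [← pow_mul]
  -- exponent bookkeeping
  have hE1 : 2 * (Z + 16) ≤ 2 ^ (Z + 11) := by rw [pow_add]; omega
  have hE2 : (2 * (Z + 16)) * 2 ^ (2 * Z + 36) ≤ 2 ^ (3 * Z + 47) := by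
    calc (2 * (Z + 16)) * 2 ^ (2 * Z + 36) ≤ 2 ^ (Z + 11) * 2 ^ (2 * Z + 36) :=
          Nat.mul_le_mul_right _ hE1
      _ = 2 ^ (3 * Z + 47) := by rw [← pow_add]; congr 1; ring
  have hE3 : 3 * Z + 56 ≤ 2 ^ (3 * Z + 47) := by
    have : 2 ^ (3 * Z + 47) = 2 ^ (3 * Z) * 2 ^ 47 := pow_add _ _ _
    rw [this]
    have h47 : (64 : ℕ) ≤ 2 ^ 47 := by norm_num
    nlinarith
  have hE : 3 * Z + 56 + (2 * (Z + 16)) * 2 ^ (2 * Z + 36) ≤ 2 ^ (3 * (Z + 16)) := by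
    have h48 : 2 ^ (3 * (Z + 16)) = 2 * 2 ^ (3 * Z + 47) := by
      rw [show 3 * (Z + 16) = (3 * Z + 47) + 1 by ring, pow_succ]; ring
    omega
  calc 60000 * (Z + 16 + 1) * 2 ^ (2 * (Z + 16 + 1) + 1) *
        (409600 * (Z + 16 + 1) ^ 2 + 1440 * (Z + 16 + 2) + b + 1) ^ (2 * 2 ^ (2 * (Z + 16 + 1) + 1))
      ≤ 2 ^ (3 * Z + 56) * 2 ^ ((2 * (Z + 16)) * 2 ^ (2 * Z + 36)) := Nat.mul_le_mul hF hS
    _ = 2 ^ (3 * Z + 56 + (2 * (Z + 16)) * 2 ^ (2 * Z + 36)) := (pow_add _ _ _).symm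
    _ ≤ 2 ^ (2 ^ (3 * (Z + 16))) := Nat.pow_le_pow_right two_pos hE

/-- `m ^ b + b < m ^ (b+1)` for `m ≥ 2`. [folklore] -/
theorem pow_add_lt_pow_succ {m : ℕ} (hm : 2 ≤ m) (b : ℕ) : m ^ b + b < m ^ (b + 1) := by
  have h2b : b < 2 ^ b := Nat.lt_two_pow_self
  have hpow : 2 ^ b ≤ m ^ b := Nat.pow_le_pow_left hm b
  have : m ^ (b + 1) = m ^ b * m := pow_succ _ _
  nlinarith

/-- **All side conditions at the tower, packaged.**  For `b + 16 ≤ X`, `Δ = X + 1`, the tower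
`m = 2^(2^(2^(3X)))` and `W = B^{2 · 2^{2Δ+1}}` (`B = 409600 Δ² + 1440 (Δ+1) + b + 1`) satisfy: `2 ≤ m`,
`1 ≤ W ≤ m`, `⌊log₂log₂log₂ m⌋ = 3X`, a polynomially larger index has `⌊log₂log₂log₂⌋ ≤ 3X + 1`,
`W ≤ μ_Δ/(30000Δ) · log m`, every `d ≥ W` clears the LST threshold with `d^{μ_Δ/2} ≥ b + 1`, and no
`s ≤ m^b + b` is `≥ m^{b+1}`. [folklore] -/
theorem tower_facts (X b Δ : ℕ) (hX : b + 16 ≤ X) (hΔ : Δ = X + 1) :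
    ∃ m W : ℕ, 2 ≤ m ∧ 1 ≤ W ∧ W ≤ m ∧
      Nat.log 2 (Nat.log 2 (Nat.log 2 m)) = 3 * X ∧
      (∀ a t : ℕ, a + 1 ≤ 2 ^ (3 * X) → t ≤ m ^ a + a →
        Nat.log 2 (Nat.log 2 (Nat.log 2 t)) ≤ 3 * X + 1) ∧
      (W : ℝ) ≤ mu Δ / (30000 * (Δ : ℝ)) * Real.log m ∧
      (∀ d : ℕ, W ≤ d →
        409600 * (Δ : ℝ) ^ 2 + 1440 * ((Δ : ℝ) + 1) ≤ (d : ℝ) ^ mu Δ ∧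
          (b : ℝ) + 1 ≤ (d : ℝ) ^ (mu Δ / 2)) ∧
      (∀ s : ℕ, s ≤ m ^ b + b → ¬ (m : ℝ) ^ ((b : ℝ) + 1) ≤ s) := by
  obtain ⟨E, hE⟩ : ∃ E : ℕ, E = 2 ^ (2 ^ (3 * X)) := ⟨_, rfl⟩
  obtain ⟨m, hm⟩ : ∃ m : ℕ, m = 2 ^ E := ⟨_, rfl⟩
  obtain ⟨q, hq⟩ : ∃ q : ℕ, q = 2 ^ (2 * (X + 1) + 1) := ⟨_, rfl⟩
  obtain ⟨B, hB⟩ : ∃ B : ℕ, B = 409600 * (X + 1) ^ 2 + 1440 * (X + 2) + b + 1 := ⟨_, rfl⟩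
  obtain ⟨W, hW⟩ : ∃ W : ℕ, W = B ^ (2 * q) := ⟨_, rfl⟩
  have hE1 : 1 ≤ E := hE ▸ Nat.one_le_two_pow
  have hm2 : 2 ≤ m := by
    rw [hm]
    calc (2 : ℕ) = 2 ^ 1 := (pow_one 2).symm
      _ ≤ 2 ^ E := Nat.pow_le_pow_right two_pos hE1
  have hmR1 : (1 : ℝ) ≤ m := by exact_mod_cast (show 1 ≤ m by omega)
  have hmpos : (0 : ℝ) < m := by linarith
  have hq1 : 1 ≤ q := hq ▸ Nat.one_le_two_pow
  have hB1 : 1 ≤ B := by rw [hB]; omega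
  have hBpos : 0 < B := hB1
  have hW1 : 1 ≤ W := by rw [hW]; exact Nat.one_le_pow _ _ hBpos
  have hΔR : (Δ : ℝ) = (X : ℝ) + 1 := by rw [hΔ]; push_cast; ring
  have hΔ1 : (1 : ℝ) ≤ Δ := by rw [hΔR]; have : (0 : ℝ) ≤ X := Nat.cast_nonneg X; linarith
  have hΔpos : (0 : ℝ) < Δ := by linarith
  have hqR : (q : ℝ) = (2 : ℝ) ^ (2 * Δ + 1) := by rw [hq, hΔ]; push_cast; ring
  have hqpos : (0 : ℝ) < q := by exact_mod_cast hq1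
  have hB0 : (0 : ℝ) ≤ B := Nat.cast_nonneg B
  have hBR : (B : ℝ) = 409600 * (Δ : ℝ) ^ 2 + 1440 * ((Δ : ℝ) + 1) + b + 1 := by
    rw [hB, hΔR]; push_cast; ring
  -- `μ_Δ ≥ 1/q`
  have hμq : 1 / (q : ℝ) ≤ mu Δ := by rw [hqR]; exact inv_two_pow_le_mu Δ
  have hμ1 : mu Δ ≤ 1 := mu_le_one _
  -- the dyadic bookkeeping, cast to `ℝ`
  have htower : 60000 * (X + 1) * q * W ≤ E := by
    rw [hW, hB, hq, hE]; exact tower_arith X b hX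
  have htR : (60000 : ℝ) * Δ * q * W ≤ E := by
    have h := (Nat.cast_le (α := ℝ)).2 htower
    rw [← hΔ] at h
    push_cast at h
    exact h
  -- `log m ≥ E/2`
  have hlogm : (E : ℝ) / 2 ≤ Real.log m := by
    have hmR : (m : ℝ) = (2 : ℝ) ^ E := by rw [hm]; push_cast; ring
    rw [hmR, Real.log_pow]
    have h2 : (1 : ℝ) / 2 ≤ Real.log 2 := by have := Real.log_two_gt_d9; linarith
    have hE0 : (0 : ℝ) ≤ E := Nat.cast_nonneg E
    calc (E : ℝ) / 2 = E * (1 / 2) := by ring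
      _ ≤ E * Real.log 2 := mul_le_mul_of_nonneg_left h2 hE0
  -- `W ≤ ε log m`
  have hWε : (W : ℝ) ≤ mu Δ / (30000 * (Δ : ℝ)) * Real.log m := by
    have hεlow : 1 / (30000 * (Δ : ℝ) * q) ≤ mu Δ / (30000 * (Δ : ℝ)) := by
      have h1 : 1 / (30000 * (Δ : ℝ) * q) = (1 / (q : ℝ)) / (30000 * (Δ : ℝ)) := by
        field_simp
      rw [h1]
      exact div_le_div_of_nonneg_right hμq (by positivity)
    have h1 : (W : ℝ) ≤ 1 / (30000 * (Δ : ℝ) * q) * ((E : ℝ) / 2) := by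
      rw [show 1 / (30000 * (Δ : ℝ) * q) * ((E : ℝ) / 2) = (E : ℝ) / (60000 * (Δ : ℝ) * q) by
        field_simp; ring]
      rw [le_div_iff₀ (by positivity)]
      linarith
    have hε0 : 0 ≤ mu Δ / (30000 * (Δ : ℝ)) := div_nonneg (mu_pos Δ).le (by positivity)
    exact h1.trans (mul_le_mul hεlow hlogm (by positivity) hε0)
  -- `W ≤ m`
  have hWm : W ≤ m := by
    have h1 : mu Δ / (30000 * (Δ : ℝ)) * Real.log m ≤ 1 * Real.log m := by
      refine mul_le_mul_of_nonneg_right ?_ (Real.log_nonneg hmR1)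
      rw [div_le_one (by positivity)]; linarith
    have h2 : Real.log m ≤ (m : ℝ) := (Real.log_le_sub_one_of_pos hmpos).trans (by linarith)
    exact_mod_cast (hWε.trans (h1.trans ((one_mul _).trans_le h2)))
  refine ⟨m, W, hm2, hW1, hWm, ?_, ?_, hWε, ?_, ?_⟩
  · rw [hm, hE]; exact log3_tower _
  · intro a t ha ht
    refine log3_le_of_le_tower_pow (3 * X) a t ha ?_
    rw [← hE, ← hm]; exact ht
  · intro d hWd
    have hd1 : (1 : ℝ) ≤ d := by exact_mod_cast hW1.trans hWd
    have hWdR : (W : ℝ) ≤ d := by exact_mod_cast hWd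
    constructor
    · have h1 : (W : ℝ) ^ (1 / (q : ℝ)) = (B : ℝ) ^ 2 := by
        rw [hW, one_div, Nat.cast_pow, pow_mul]
        exact Real.pow_rpow_inv_natCast (by positivity) (by omega)
      have h2 : (W : ℝ) ^ (1 / (q : ℝ)) ≤ (d : ℝ) ^ (1 / (q : ℝ)) :=
        Real.rpow_le_rpow (Nat.cast_nonneg W) hWdR (by positivity)
      have h3 : (d : ℝ) ^ (1 / (q : ℝ)) ≤ (d : ℝ) ^ mu Δ :=
        Real.rpow_le_rpow_of_exponent_le hd1 hμq
      have hB1R : (1 : ℝ) ≤ B := by exact_mod_cast hB1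
      have h4 : (B : ℝ) ≤ (B : ℝ) ^ 2 := by nlinarith
      have hb0 : (0 : ℝ) ≤ b := Nat.cast_nonneg b
      calc 409600 * (Δ : ℝ) ^ 2 + 1440 * ((Δ : ℝ) + 1) ≤ (B : ℝ) := by rw [hBR]; linarith
        _ ≤ (B : ℝ) ^ 2 := h4
        _ = (W : ℝ) ^ (1 / (q : ℝ)) := h1.symm
        _ ≤ (d : ℝ) ^ mu Δ := h2.trans h3
    · have h1 : (W : ℝ) ^ (1 / ((2 * q : ℕ) : ℝ)) = (B : ℝ) := by
        rw [hW, one_div, Nat.cast_pow]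
        exact Real.pow_rpow_inv_natCast hB0 (by omega)
      have h2 : (W : ℝ) ^ (1 / ((2 * q : ℕ) : ℝ)) ≤ (d : ℝ) ^ (1 / ((2 * q : ℕ) : ℝ)) :=
        Real.rpow_le_rpow (Nat.cast_nonneg W) hWdR (by positivity)
      have h3 : (d : ℝ) ^ (1 / ((2 * q : ℕ) : ℝ)) ≤ (d : ℝ) ^ (mu Δ / 2) := by
        refine Real.rpow_le_rpow_of_exponent_le hd1 ?_
        have : 1 / ((2 * q : ℕ) : ℝ) = (1 / (q : ℝ)) / 2 := by
          push_cast; field_simp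
        rw [this]; linarith
      have hpos : (0 : ℝ) ≤ 409600 * (Δ : ℝ) ^ 2 + 1440 * ((Δ : ℝ) + 1) := by positivity
      calc (b : ℝ) + 1 ≤ B := by rw [hBR]; linarith
        _ = (W : ℝ) ^ (1 / ((2 * q : ℕ) : ℝ)) := h1.symm
        _ ≤ (d : ℝ) ^ (mu Δ / 2) := h2.trans h3
  · intro s hs hle
    have hnat : m ^ b + b < m ^ (b + 1) := pow_add_lt_pow_succ hm2 b
    have hup : (s : ℝ) ≤ ((m ^ b + b : ℕ) : ℝ) := by exact_mod_cast hs
    have hlt : ((m ^ b + b : ℕ) : ℝ) < (m : ℝ) ^ ((b : ℝ) + 1) := by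
      calc ((m ^ b + b : ℕ) : ℝ) < ((m ^ (b + 1) : ℕ) : ℝ) := by exact_mod_cast hnat
        _ = (m : ℝ) ^ ((b : ℝ) + 1) := by
            rw [show ((b : ℝ) + 1) = ((b + 1 : ℕ) : ℝ) by push_cast; ring, Real.rpow_natCast]
            push_cast; ring
    exact absurd (hle.trans hup) (not_le.2 hlt)

/-! ### The growing-depth rung -/

/-- **The growing-depth rung, PROVED** (`κ = 1/3`): the permanent has no polynomial-wire circuits over `ℂ`
of product-depth `≤ ⌊log₂⌊log₂⌊log₂ n⌋⌋⌋ / 3` — the statement of the crux `PerHardLog3` (product-depth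
`⌊log₂⌊log₂⌊log₂ n⌋⌋⌋ + 1`) one `log log log`-unit lower, and the first kernel theorem of the route with an
UNBOUNDED product-depth.  Limaye–Srinivasan–Tavenas with explicit constants (`lst_explicit`) for the `VP`
family `m ↦ IMM_{m, d(m)}` transported to the `VNP`-complete permanent along a p-projection
(`isVNPComplete_perPoly_holds`, `exists_circuit_of_isProjection`), evaluated at one tower
`m = 2^(2^(2^(3X)))` (`tower_facts`).
[cite: LimayeSrinivasanTavenas2025, Cor. 4] [cite: Valiant1979] -/
theorem perHardGrowingDepth :
    ¬ ∃ c : ℕ, ∀ n : ℕ, ∃ C : ArithCircuit ℂ (Fin n × Fin n),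
      C.Computes (perPoly (Fin n) ℂ) ∧ C.productDepth ≤ Nat.log 2 (Nat.log 2 (Nat.log 2 n)) / 3 ∧
        C.edgeSize ≤ n ^ c + c := by
  classical
  rintro ⟨c, hc⟩
  -- the depth at which LST is applied, its `ε`, and the degree function
  let Dp : ℕ → ℕ := fun m => Nat.log 2 (Nat.log 2 (Nat.log 2 m)) / 3 + 1
  let ee : ℕ → ℝ := fun m => mu (Dp m) / (30000 * (Dp m : ℝ))
  let dd : ℕ → ℕ := fun m => min m ⌊ee m * Real.log m⌋₊
  have hdd_le : ∀ m, dd m ≤ m := fun m => min_le_left _ _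
  have hee0 : ∀ m, 0 ≤ ee m := fun m => div_nonneg (mu_pos _).le (by positivity)
  have hdd_log : ∀ m, (dd m : ℝ) ≤ ee m * Real.log m := fun m => by
    have h0 : 0 ≤ ee m * Real.log m := mul_nonneg (hee0 m) (Real.log_natCast_nonneg m)
    exact (Nat.cast_le.2 (min_le_right _ _)).trans (Nat.floor_le h0)
  -- the IMM family and its renaming to `Fin (v m)` variables
  let v : ℕ → ℕ := fun m => Fintype.card (Fin (dd m) × Fin m × Fin m)
  let e : ∀ m, (Fin (dd m) × Fin m × Fin m) ≃ Fin (v m) := fun m => Fintype.equivFin _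
  let G : ∀ m, MvPolynomial (Fin (dd m) × Fin m × Fin m) ℂ := fun m => immPoly m (dd m) ℂ
  let G' : ∀ m, MvPolynomial (Fin (v m)) ℂ := fun m => renameEquiv ℂ (e m) (G m)
  have hG : IsVPFamily G := by
    refine ⟨⟨⟨3, fun m => ?_⟩, ⟨1, fun m => ?_⟩⟩, ⟨6, fun m => ?_⟩⟩
    · show Fintype.card (Fin (dd m) × Fin m × Fin m) ≤ m ^ 3 + 3
      simp only [Fintype.card_prod, Fintype.card_fin]
      calc dd m * (m * m) ≤ m * (m * m) := Nat.mul_le_mul_right _ (hdd_le m)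
        _ = m ^ 3 := by ring
        _ ≤ m ^ 3 + 3 := Nat.le_add_right _ _
    · show (immPoly m (dd m) ℂ).totalDegree ≤ m ^ 1 + 1
      refine ((immPoly_isHomogeneous_holds (k := ℂ) m (dd m)).totalDegree_le).trans ?_
      rw [pow_one]; exact (hdd_le m).trans (Nat.le_succ m)
    · show complexity (immPoly m (dd m) ℂ) ≤ m ^ 6 + 6
      calc complexity (immPoly m (dd m) ℂ) ≤ m + 2 * m ^ 3 * dd m := complexity_immPoly_le ℂ m (dd m)
        _ ≤ m ^ 1 + 2 * (m ^ 1) ^ 3 * m := by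
            rw [pow_one]; exact Nat.add_le_add_left (Nat.mul_le_mul_left _ (hdd_le m)) _
        _ ≤ m ^ (3 * 1 + 3) + (3 * 1 + 3) := imm_cost_le 1 m
        _ = m ^ 6 + 6 := by norm_num
  have hG' : IsVPFamily G' := (isVPFamily_renameEquiv_iff e G).2 hG
  have hG'N : IsVNPFamily G' := IsVPFamily.isVNPFamily_holds' hG'
  -- VNP-completeness of the permanent over ℂ: `G'` is a p-projection of `per`
  obtain ⟨t, ht, hproj⟩ := (isVNPComplete_perPoly_holds ℂ ringChar_complex_ne_two).2 v G' hG'N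
  obtain ⟨b, hb⟩ : IsPBounded fun m => t m ^ c + c :=
    IsPBounded.comp_holds (s := fun N => N ^ c + c) ⟨c, fun N => le_rfl⟩ ht
  obtain ⟨a, ha⟩ := ht
  -- circuits with few gates for `G m = IMM_{m, dd m}`, of product-depth `≤ ⌊log₂log₂log₂ (t m)⌋ / 3`
  have key : ∀ m, ∃ D : ArithCircuit ℂ (Fin (dd m) × Fin m × Fin m),
      D.Computes (G m) ∧ D.productDepth ≤ Nat.log 2 (Nat.log 2 (Nat.log 2 (t m))) / 3 ∧
        D.size ≤ m ^ b + b := by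
    intro m
    obtain ⟨C, hCc, hCd, hCe⟩ := hc (t m)
    obtain ⟨D', hD'c, hD'd, hD'e, -⟩ := exists_circuit_of_isProjection (hproj m) C hCc
    have hGm : MvPolynomial.rename (e m).symm (G' m) = G m := by
      show MvPolynomial.rename (e m).symm (renameEquiv ℂ (e m) (G m)) = G m
      rw [renameEquiv_apply, rename_rename, (e m).symm_comp_self, rename_id_apply]
    obtain ⟨D, hDe, hDd, hDw, hDs⟩ := exists_size_le_edgeSize (D'.rename (e m).symm)
    refine ⟨D, ?_, ?_, ?_⟩
    · rw [Computes, hDe, ← hGm]; exact hD'c.rename (e m).symm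
    · exact hDd.trans ((DepthThreeChasm.productDepth_rename _ _).le.trans (hD'd.trans hCd))
    · calc D.size ≤ D.edgeSize := hDs
        _ ≤ (D'.rename (e m).symm).edgeSize := hDw
        _ = D'.edgeSize := DepthThreeChasm.edgeSize_rename _ _
        _ ≤ C.edgeSize := hD'e
        _ ≤ t m ^ c + c := hCe
        _ ≤ m ^ b + b := hb m
  -- the tower `m = 2^(2^(2^(3X)))`, `X = a + b + 16`, and the depth `Δ = X + 1`
  obtain ⟨X, hXa, hXb⟩ : ∃ X : ℕ, a + 1 ≤ 2 ^ (3 * X) ∧ b + 16 ≤ X := by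
    refine ⟨a + b + 16, ?_, by omega⟩
    have : 3 * (a + b + 16) < 2 ^ (3 * (a + b + 16)) := Nat.lt_two_pow_self
    omega
  obtain ⟨Δ, hΔ⟩ : ∃ Δ : ℕ, Δ = X + 1 := ⟨_, rfl⟩
  have hΔ1 : 1 ≤ Δ := by omega
  obtain ⟨m, W, hm2, hW1, hWm, hL3m, hlog3t, hWε, hthr, hfin⟩ := tower_facts X b Δ hXb hΔ
  have hDp : Dp m = Δ := by
    show Nat.log 2 (Nat.log 2 (Nat.log 2 m)) / 3 + 1 = Δ
    rw [hL3m, hΔ]; omega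
  have hεm : ee m = mu Δ / (30000 * (Δ : ℝ)) := by
    show mu (Dp m) / (30000 * (Dp m : ℝ)) = _; rw [hDp]
  have hWdd : W ≤ dd m := by
    refine le_min hWm (Nat.le_floor ?_)
    rw [hεm]; exact hWε
  have hdd1 : 1 ≤ dd m := hW1.trans hWdd
  obtain ⟨hdμ, hexp⟩ := hthr (dd m) hWdd
  have hdn : (dd m : ℝ) ≤ mu Δ / (30000 * (Δ : ℝ)) * Real.log m := hεm ▸ hdd_log m
  -- the transported circuit at `m` has product-depth `≤ Δ`
  obtain ⟨D, hDc, hDd, hDs⟩ := key m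
  have hY : Nat.log 2 (Nat.log 2 (Nat.log 2 (t m))) ≤ 3 * X + 1 := hlog3t a (t m) hXa (ha m)
  have hDΔ : D.productDepth ≤ Δ := hDd.trans (by omega)
  -- LST with explicit constants at depth `Δ`, and the contradiction `m^{b+1} ≤ size ≤ m^b + b`
  have hlow : (m : ℝ) ^ ((dd m : ℝ) ^ (mu Δ / 2)) ≤ (D.size : ℝ) :=
    lst_explicit ℂ hΔ1 m (dd m) hdd1 hdμ hdn D hDΔ hDc
  have hmR1 : (1 : ℝ) ≤ m := by exact_mod_cast (show 1 ≤ m by omega)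
  exact hfin D.size hDs ((Real.rpow_le_rpow_of_exponent_le hmR1 hexp).trans hlow)

/-- **Registered-stub form** (crux `PerHardLog3`; one `log log log`-unit below it): for every exponent `c`
some `per_n` has NO circuit of product-depth `≤ ⌊log₂⌊log₂⌊log₂ n⌋⌋⌋ / 3` with `≤ n ^ c + c` wires.
[cite: LimayeSrinivasanTavenas2025, Cor. 4] -/
theorem perHardGrowingDepth_lst : ∀ c : ℕ, ∃ n : ℕ, ∀ C : ArithCircuit ℂ (Fin n × Fin n), C.Computes (perPoly (Fin n) ℂ) → C.productDepth ≤ Nat.log 2 (Nat.log 2 (Nat.log 2 n)) / 3 → n ^ c + c < C.edgeSize := by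
  intro c
  by_contra h
  refine perHardGrowingDepth ⟨c, fun n => ?_⟩
  by_contra hn
  exact h ⟨n, fun C hC hd => not_le.mp fun hle => hn ⟨C, hC, hd, hle⟩⟩

end

end Summit.ValiantsHypothesis.ValiantsHypothesis.Theorems.DepthWindow
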